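import Mathlib
import HarnessLib
import Literature.MathematicalPhysics.QuantumLattice.SectorisedEffectiveActionBoundPlateau
import Literature.MathematicalPhysics.QuantumLattice.GrassmannChargeScaling
import Summits.HubbardSuperconductivity.HubbardSuperconductivity.Theorems.KLProgrammeKLRegimeEngineV8E5Share
import Summits.HubbardSuperconductivity.HubbardSuperconductivity.Theorems.KLProgrammeKLRegimeWickCrossContractionGramTailValue
import Summits.HubbardSuperconductivity.HubbardSuperconductivity.Theorems.KLProgrammeKLRegimeWickCrossContractionTailPushforward

/-!
# Route `KLProgramme` — ENGINE child gen 8 (stmt-HubbardSuperconductivity-20437 `KLRegimeEngineV17F2`), SKELETON v2 class #3, PROVING side: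
# the E.5 block `klE5Block` bounded from LINE DATA and VERTEX LEVEL NORMS — the glue of the `∃ (C,u), E5ShareStep P R C u` witness
# (cell gate-hubbard-kl, seat p5 g7; recipe HOME/prover-p5/E5-GAIN-SCALE-N.md §12)

`…EngineV8E5Share` (p541670) DEFINED the E.5 block `klE5Block … κ V Λ Qm x y` of the within-slice source (κ/V-parametric: (R1′) `klE5BlockR1`, bare
`klE5BlockBare`) and the step Prop `E5ShareStep P R C u` whose `∃ (C,u)` witness feeds `klE5Raise`/`klE5ShareU` (read by DefsQ8/DefsU10).  This file is the
MODEL-FREE GLUE of that witness — the recipe of HOME/prover-p5/E5-GAIN-SCALE-N.md §12 as theorems, every line datum and every vertex size a hypothesis: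

* §1 **dead variables** (`kernel_dblFold_crossLaplacian_sum_pow_map_mulLeft_eq`): a leg rescaling `S_r = map (mulLeft r)` on BOTH copies of a
  weighted two-vertex block `dblFold(Δ_×(g)((Σ_{i∈S} c_i•Δ_×(D)^i)(a⁰b¹)))` is invisible at an output tuple `X′` as soon as `r = 1` on both legs of every
  nonzero entry of `g`, `D` and on `X′` (`mulLeft r = toLin' (diagonal r)`, `dblFold_crossLaplacian_mul_pow_map`, `kernel_map_mulLeft`);
* §2 **`norm_klE5Block_le_of_tails`**: for a thin/fat pair `(F, F̃)` (`F̃F = F`, `Σ_ωF_ω = 0 ⇒ F_ω = 0`) whose plateau `{Σ_ω F_ω = 1}` carries the lines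
  `Ċ_Λ = klE5DressedSliceDeriv … Λ`, `C∞ − C_Λ = klE5Total − klE5DressedSlice … Λ` and the four pair labels, the block equals the block of `S_R W_Λ`
  (`R = Σ_ωF_ω`, §1) `= map S(F̃) (sectorPreimage β F W_Λ)` (`map_sectorSub_sectorPreimage_eq_map_mulLeft`, Literature …Plateau), so the push-forward
  (`norm_kernel_dblFold_crossLaplacian_sum_pow_map_le_of_tails`, the colouring-wise TAIL form of p533230's lemma) gives
  `‖klE5Block … κ V Λ Qm x y‖ ≤ 4!·|βL²|³·R₁⁴·Σ_{s : Fin 4 → Fin 2} T s` from row sums `≤ R₁` of `‖S(F̃)‖` (`sum_norm_sectorSubMatrix_le`) and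
  per-colouring bounds `T s` of `Σ_{i∈Icc 2 (|idx|+1)} (i!)⁻¹‖kernel((Δ_×(SᵀDS)^i·Δ_×(SᵀĊS))(a′⁰a′¹)) 4 (Z,s)‖`, uniformly in the sector-field tuple `Z`;
* §3 `sum_norm_kernel_pow_mul_sectorPreimage_le_gramTail(_of_b)`: the `(i!)⁻¹`-weighted tail in exactly that shape from LINE DATA (`α` row/column
  sums of the pulled-back line `0`, `δ` entries of the `e'` explicit soft lines, Gram constants `κ`) and per-line-number LEVEL NORMS with ONE envelope —
  `…_le_gramTail_mul(_of_b)` (p532413) re-indexed by `k = i + 1` (`sum_Icc_succ_shift`, `listProd_ite_zero_eq_pow_mul`, p539100);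
* §4 **`klE5_tail_le_of_lineData(_of_b)`**: §3 at `e' = 2`, `m = 4`, both vertices the carrier `W_Λ = klE5Carrier … κ V Λ`, lines presented by ANY
  symbol family `sym` with `normalCovariance (sym s₀) = Ċ_Λ`, `normalCovariance (sym s₁) = C∞ − C_Λ` — literally hypothesis `hT` of §2 at colouring `s`
  (main form: `≥ 1` leg from copy `0`; `_of_b`: `≥ 1` leg from copy `1`): `T s = ((m₀+m₁+5)!/(4!(1−x)^{m₀+m₁+6}))·α·(δ·4ρ₀)²·A_s`.

What the `∃ (C,u), E5ShareStep P R C u` proof still supplies (all by name elsewhere or owed): the pair `(F, F̃)` and its plateau at the step's scale,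
`R₁` (`sum_norm_sectorSubMatrix_le`), the symbols with `α` (GAP L1: dressed `Ċ_Λ` row sums), `δ`/`κ` (GAP L2: sharp soft-covariance sector data,
k3c2-p2 `softLine_sector_*`), the carrier's level norms along the slice (class #5 / RIDER (A)) with the envelope `x ≤ 1/2` below `klE5ShareU`, and the
slice measure `(Λ_{n−1} − Λ_n)`.  Pure bookkeeping over landed theorems; no definitions, no named facts, nothing about the model's sizes is asserted;
nothing asserts superconductivity.
-/

noncomputable section

namespace Summit.HubbardSuperconductivity.HubbardSuperconductivity.Theorems.KLRegimeSplit

set_option linter.dupNamespace false -- summit = problem name (single-conjunct summit), D-0017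

open Real Finset Literature.MathematicalPhysics.QuantumLattice Literature.Probability.LatticeModels GrassmannAlgebra Matrix
open Literature.MathematicalPhysics.QuantumLattice.FermiRG
open Summit.HubbardSuperconductivity.HubbardSuperconductivity.Theorems.KLRegimeWick

/-! ## §1 Dead variables: the block does not see a leg rescaling that is `1` on the lines and on the output legs -/

section DeadVariables

variable {Γ : Type*} [Fintype Γ] [DecidableEq Γ]

/-- The substitution `v ↦ r·v` is the diagonal matrix `diagonal r`. [folklore] -/
theorem mulLeft_eq_toLin'_diagonal (r : Γ → ℂ) : LinearMap.mulLeft ℂ r = Matrix.toLin' (Matrix.diagonal r) := by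
  refine LinearMap.ext fun v => ?_
  funext i
  rw [LinearMap.mulLeft_apply, Matrix.toLin'_apply, Matrix.mulVec_diagonal, Pi.mul_apply]

/-- `diagonal r · C · diagonal r = C` when `r = 1` on both legs of every nonzero entry of `C`. [folklore] -/
theorem diagonal_mul_mul_diagonal_eq_of_eq_one (r : Γ → ℂ) (C : Matrix Γ Γ ℂ) (hC : ∀ X Y, C X Y ≠ 0 → r X = 1 ∧ r Y = 1) :
    (Matrix.diagonal r).transpose * C * Matrix.diagonal r = C := by
  ext X Y
  rw [Matrix.diagonal_transpose, Matrix.mul_diagonal, Matrix.diagonal_mul]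
  by_cases h : C X Y = 0
  · rw [h, mul_zero, zero_mul]
  · rw [(hC X Y h).1, (hC X Y h).2, one_mul, mul_one]

/-- **Dead variables for a weighted two-vertex block**: if the leg multiplier `r` equals `1` on both legs of every nonzero entry of the lines `g`, `D`
and on the output legs `X′`, then the kernel at `X′` of `dblFold(Δ_×(g)((Σ_{i∈S} c_i • Δ_×(D)^i)((S_r a)⁰·(S_r b)¹)))` equals that with `a`, `b`
(`S_r = map (mulLeft r)`). [folklore] -/
theorem kernel_dblFold_crossLaplacian_sum_pow_map_mulLeft_eq {m : ℕ} (r : Γ → ℂ) (g D : Matrix Γ Γ ℂ) (S : Finset ℕ) (c : ℕ → ℂ)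
    (a b : GrassmannAlgebra ℂ Γ) (X' : Fin m → Γ) (hg : ∀ X Y, g X Y ≠ 0 → r X = 1 ∧ r Y = 1) (hD : ∀ X Y, D X Y ≠ 0 → r X = 1 ∧ r Y = 1)
    (hX : ∀ i, r (X' i) = 1) :
    kernel ℂ (dblFold ℂ (grassmannLaplacian ℂ (crossCov ℂ g)
        ((∑ i ∈ S, c i • grassmannLaplacian ℂ (crossCov ℂ D) ^ i)
          (dblCopy ℂ 0 (ExteriorAlgebra.map (LinearMap.mulLeft ℂ r) a) * dblCopy ℂ 1 (ExteriorAlgebra.map (LinearMap.mulLeft ℂ r) b))))) m X' =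
      kernel ℂ (dblFold ℂ (grassmannLaplacian ℂ (crossCov ℂ g)
        ((∑ i ∈ S, c i • grassmannLaplacian ℂ (crossCov ℂ D) ^ i) (dblCopy ℂ 0 a * dblCopy ℂ 1 b)))) m X' := by
  rw [mulLeft_eq_toLin'_diagonal, LinearMap.sum_apply, LinearMap.sum_apply, map_sum, map_sum, map_sum, map_sum, kernel_sum, kernel_sum]
  refine sum_congr rfl fun i _ => ?_
  rw [LinearMap.smul_apply, LinearMap.smul_apply, map_smul, map_smul, map_smul, map_smul, kernel_smul, kernel_smul,
    dblFold_crossLaplacian_mul_pow_map, diagonal_mul_mul_diagonal_eq_of_eq_one r g hg, diagonal_mul_mul_diagonal_eq_of_eq_one r D hD,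
    ← mulLeft_eq_toLin'_diagonal, kernel_map_mulLeft, prod_eq_one (fun i _ => hX i), one_mul]
  congr 2
  rw [← Module.End.mul_apply, ((commute_grassmannLaplacian ℂ (crossCov ℂ g) (crossCov ℂ D)).pow_right i).eq]

end DeadVariables

/-! ## §2 The block bound from colouring-wise bounds of the sector-field tails (push-forward + dead variables) -/

section BlockBound

variable {L M N : ℕ} [NeZero L] [NeZero M] (β μ : ℝ) (K : TrigPolyC4v) (n₀ : ℕ) (κ : FreqMomentum L M × Fin 2 → ℂ)
  (V : HubbardGrassmann L M) (Λ : ℝ) (Qm : TorusSite 2 L) (x y : TorusSite 2 L × MatsubaraIdx M)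

/-- **Push-forward of a weighted sum of two-vertex line terms, colouring-wise tail form**: with the row sums of `‖M‖` at most `R` and per-colouring
bounds `T s ≥ 0` of the WEIGHTED SUM `Σ_{i∈S} ‖c_i‖·‖kernel((Δ_×(MᵀDM)^i·Δ_×(MᵀgM))(a′⁰·b′¹)) m (X, s)‖` (uniform in the labelled tuple `X`),
`‖kernel(dblFold(Δ_×(g)((Σ_{i∈S} c_i • Δ_×(D)^i)((map M a′)⁰·(map M b′)¹)))) m X′‖ ≤ R^m · Σ_s T s`. [folklore] -/
theorem norm_kernel_dblFold_crossLaplacian_sum_pow_map_le_of_tails {Γ Γ' : Type*} [Fintype Γ] [DecidableEq Γ] [Fintype Γ'] [DecidableEq Γ']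
    {m : ℕ} (Mx : Matrix Γ' Γ ℂ) (g D : Matrix Γ' Γ' ℂ) (S : Finset ℕ) (c : ℕ → ℂ)
    (a' b' : GrassmannAlgebra ℂ Γ) (X' : Fin m → Γ') {R : ℝ} (hrow : ∀ p, ∑ q, ‖Mx p q‖ ≤ R)
    (T : (Fin m → Fin 2) → ℝ) (hT0 : ∀ s, 0 ≤ T s)
    (hT : ∀ (s : Fin m → Fin 2) (X : Fin m → Γ), ∑ i ∈ S, ‖c i‖ *
      ‖kernel ℂ ((grassmannLaplacian ℂ (crossCov ℂ (Mx.transpose * D * Mx)) ^ i * grassmannLaplacian ℂ (crossCov ℂ (Mx.transpose * g * Mx)))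
        (dblCopy ℂ 0 a' * dblCopy ℂ 1 b')) m (fun j => (X j, s j))‖ ≤ T s) :
    ‖kernel ℂ (dblFold ℂ (grassmannLaplacian ℂ (crossCov ℂ g)
        ((∑ i ∈ S, c i • grassmannLaplacian ℂ (crossCov ℂ D) ^ i)
          (dblCopy ℂ 0 (ExteriorAlgebra.map (Matrix.toLin' Mx) a') * dblCopy ℂ 1 (ExteriorAlgebra.map (Matrix.toLin' Mx) b'))))) m X'‖ ≤
      R ^ m * ∑ s : Fin m → Fin 2, T s := by
  have key : dblFold ℂ (grassmannLaplacian ℂ (crossCov ℂ g)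
      ((∑ i ∈ S, c i • grassmannLaplacian ℂ (crossCov ℂ D) ^ i)
        (dblCopy ℂ 0 (ExteriorAlgebra.map (Matrix.toLin' Mx) a') * dblCopy ℂ 1 (ExteriorAlgebra.map (Matrix.toLin' Mx) b')))) =
      ExteriorAlgebra.map (Matrix.toLin' Mx) (dblFold ℂ
        ((∑ i ∈ S, c i • ((grassmannLaplacian ℂ (crossCov ℂ (Mx.transpose * D * Mx)) ^ i *
            grassmannLaplacian ℂ (crossCov ℂ (Mx.transpose * g * Mx)))))
          (dblCopy ℂ 0 a' * dblCopy ℂ 1 b'))) := by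
    rw [LinearMap.sum_apply, LinearMap.sum_apply, map_sum, map_sum, map_sum, map_sum]
    refine sum_congr rfl fun i _ => ?_
    rw [LinearMap.smul_apply, LinearMap.smul_apply, map_smul, map_smul, map_smul, map_smul, dblFold_crossLaplacian_mul_pow_map]
  rw [key]
  refine norm_kernel_map_dblFold_le_of_rowSum _ _ m X' (fun p => by simpa only [LinearMap.toMatrix'_toLin'] using hrow p) T hT0
    fun s X => ?_
  rw [LinearMap.sum_apply, kernel_sum]
  refine (norm_sum_le _ _).trans (le_trans (sum_le_sum fun i _ => ?_) (hT s X))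
  rw [LinearMap.smul_apply, kernel_smul, norm_mul]

/-- **The E.5 block bounded by colouring-wise tail bounds** (push-forward `R⁴`, dead variables, `𝒱₄ = 4!(βL²)³·kernel`): for a thin/fat pair
`(F, F̃)` (`F̃·F = F`, `Σ_ω F_ω = 0 ⇒ F_ω = 0`) whose plateau `{Σ_ω F_ω = 1}` contains both legs of every nonzero entry of the lines `Ċ_Λ`
(`klE5DressedSliceDeriv`) and `C∞ − C_Λ` (`klE5Total − klE5DressedSlice Λ`) and the four pair labels, row sums of `‖S(F̃)‖` at most `R`, and
per-colouring bounds `T s` of the `(i!)⁻¹`-weighted line-number tail of the SECTOR-FIELD two-vertex terms of the preimage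
`a′ = sectorPreimage β F W_Λ` with the pulled-back lines (uniformly in the labelled sector-field tuple):
`‖klE5Block … κ V Λ Qm x y‖ ≤ 4!·|βL²|³·R⁴·Σ_s T s`. [cite: BenfattoGiulianiMastropietro2006, §2.7 (2.70)] -/
theorem norm_klE5Block_le_of_tails (hβ : β ≠ 0) (F Ft : Fin N → FreqMomentum L M → ℂ)
    (hFF : ∀ ω k, Ft ω k * F ω k = F ω k) (hF0 : ∀ k, ∑ ω, F ω k = 0 → ∀ ω, F ω k = 0)
    (hĊ : ∀ X Y, klE5DressedSliceDeriv L M β μ K n₀ κ Λ X Y ≠ 0 → ∑ ω, F ω X.1.1 = 1 ∧ ∑ ω, F ω Y.1.1 = 1)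
    (hD : ∀ X Y, (klE5Total L M β μ K n₀ κ - klE5DressedSlice L M β μ K n₀ κ Λ) X Y ≠ 0 → ∑ ω, F ω X.1.1 = 1 ∧ ∑ ω, F ω Y.1.1 = 1)
    (hx : ∑ ω, F ω (x.2, x.1) = 1) (hx' : ∑ ω, F ω (x.2.rev, Qm - x.1) = 1)
    (hy : ∑ ω, F ω (y.2, y.1) = 1) (hy' : ∑ ω, F ω (y.2.rev, Qm - y.1) = 1)
    {R : ℝ} (hS : ∀ X, ∑ Y, ‖sectorSubMatrix L M β Ft X Y‖ ≤ R)
    (T : (Fin 4 → Fin 2) → ℝ) (hT0 : ∀ s, 0 ≤ T s)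
    (hT : ∀ (s : Fin 4 → Fin 2) (Z : Fin 4 → SpaceTimeIdx L M × SectorLeg N),
      ∑ i ∈ Finset.Icc 2 (Fintype.card (HubbardFieldIdx L M × Fin 2) + 1), ((i.factorial : ℝ))⁻¹ *
        ‖kernel ℂ ((grassmannLaplacian ℂ (crossCov ℂ ((sectorSubMatrix L M β Ft).transpose *
              (klE5Total L M β μ K n₀ κ - klE5DressedSlice L M β μ K n₀ κ Λ) * sectorSubMatrix L M β Ft)) ^ i *
            grassmannLaplacian ℂ (crossCov ℂ ((sectorSubMatrix L M β Ft).transpose * klE5DressedSliceDeriv L M β μ K n₀ κ Λ *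
              sectorSubMatrix L M β Ft)))
          (dblCopy ℂ 0 (sectorPreimage β F (klE5Carrier L M β μ K n₀ κ V Λ)) *
            dblCopy ℂ 1 (sectorPreimage β F (klE5Carrier L M β μ K n₀ κ V Λ)))) 4 (fun j => (Z j, s j))‖ ≤ T s) :
    ‖klE5Block L M β μ K n₀ κ V Λ Qm x y‖ ≤ ((4 : ℕ).factorial : ℝ) * |β * (L : ℝ) ^ 2| ^ 3 * (R ^ 4 * ∑ s : Fin 4 → Fin 2, T s) := by
  -- notation
  set W : HubbardGrassmann L M := klE5Carrier L M β μ K n₀ κ V Λ with hW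
  set r : HubbardFieldIdx L M → ℂ := fun X => ∑ ω, F ω X.1.1 with hr
  set X' : Fin 4 → HubbardFieldIdx L M :=
    ![(((y.2, y.1), 0), 0), (((y.2.rev, Qm - y.1), 1), 0), (((x.2.rev, Qm - x.1), 1), 1), (((x.2, x.1), 0), 1)] with hX'
  have hX'r : ∀ i, r (X' i) = 1 := by
    intro i
    fin_cases i
    · exact hy
    · exact hy'
    · exact hx'
    · exact hx
  -- (1) dead variables: replace both copies of `W` by `S_r W`
  have h1 := kernel_dblFold_crossLaplacian_sum_pow_map_mulLeft_eq r (klE5DressedSliceDeriv L M β μ K n₀ κ Λ)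
    (klE5Total L M β μ K n₀ κ - klE5DressedSlice L M β μ K n₀ κ Λ) (Finset.Icc 2 (Fintype.card (HubbardFieldIdx L M × Fin 2) + 1))
    (fun i => ((i.factorial : ℂ))⁻¹) W W X' hĊ hD hX'r
  -- (2) `S_r W` is the push-forward of the sector preimage
  have h2 : ExteriorAlgebra.map (LinearMap.mulLeft ℂ r) W =
      ExteriorAlgebra.map (Matrix.toLin' (sectorSubMatrix L M β Ft)) (sectorPreimage β F W) :=
    (map_sectorSub_sectorPreimage_eq_map_mulLeft hβ F Ft hFF hF0 W).symm
  -- (3) assemble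
  unfold klE5Block
  rw [vertexFn_def, norm_mul, Complex.norm_real, Real.norm_eq_abs, abs_mul, abs_pow, Nat.abs_cast]
  simp only [Nat.add_one_sub_one]
  refine mul_le_mul_of_nonneg_left ?_ (by positivity)
  rw [← hW, ← hX', ← h1, h2]
  refine norm_kernel_dblFold_crossLaplacian_sum_pow_map_le_of_tails _ _ _ _ _ _ _ X' hS T hT0 fun s Z => ?_
  refine le_trans (le_of_eq (sum_congr rfl fun i _ => ?_)) (hT s Z)
  rw [norm_inv_natCast_factorial]

end BlockBound

/-! ## §3 The colouring-wise tails from LINE DATA and LEVEL NORMS (`…GramTailValue` `_mul` forms, `e'` explicit soft lines) -/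

section Tails

variable {L M N : ℕ} [NeZero L] {ι : Type*} [Fintype ι] [DecidableEq ι]

omit [Fintype ι] [DecidableEq ι] in
/-- Matching the block's `i`-th term (`Δ_×(D)^i·Δ_×(g)`, weight `(i!)⁻¹`) with the bridge's `k = i + 1`-line list (two-symbol family, line `0` = `g`). -/
private theorem pow_mul_eq_listProd (S : Matrix (HubbardFieldIdx L M) (SpaceTimeIdx L M × SectorLeg N) ℂ)
    (sym : ι → FreqMomentum L M × Fin 2 → ℂ) (s₀ s₁ : ι) (i : ℕ) :
    grassmannLaplacian ℂ (crossCov ℂ (S.transpose * normalCovariance L M (sym s₁) * S)) ^ i *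
        grassmannLaplacian ℂ (crossCov ℂ (S.transpose * normalCovariance L M (sym s₀) * S)) =
      ((List.ofFn fun j : Fin (i + 1) => grassmannLaplacian ℂ (crossCov ℂ
        (S.transpose * normalCovariance L M (sym (if (j : ℕ) = 0 then s₀ else s₁)) * S))).reverse).prod := by
  rw [← listProd_ite_zero_eq_pow_mul ℂ (S.transpose * normalCovariance L M (sym s₀) * S) (S.transpose * normalCovariance L M (sym s₁) * S) i]
  congr 2
  refine congrArg List.ofFn (funext fun j => ?_)
  split_ifs <;> rfl

/-- **The `(i!)⁻¹`-weighted line-number tail from line data, generic vertices** (main form: `m₀ + 1 ≥ 1` output legs from `a`; `e'` explicit lines of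
symbol `s₁` besides line `0` of symbol `s₀`; hypotheses = those of `sum_norm_kernel_crossContract_value_sectorPreimage_le_gramTail_mul` at line numbers
`k = i + 1 ∈ Icc (e'+1) (Nm+1)`):
`Σ_{i∈Icc e' Nm} (i!)⁻¹‖kernel((Δ_×(Sᵀ·nC(s₁)·S)^i·Δ_×(Sᵀ·nC(s₀)·S))(Ga′⁰Gb′¹)) m (Z,s)‖ ≤ ((m₀+1+m₁+(e'+1)+1)!/(m!(1−x)^{m₀+1+m₁+(e'+1)+2}))·(α·(δ·4ρ₀)^{e'}·A)`.
[cite: BenfattoGiulianiMastropietro2006, §2.8 (2.80)] -/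
theorem sum_norm_kernel_pow_mul_sectorPreimage_le_gramTail {e' m m₀ m₁ Nm : ℕ} {β : ℝ} (hβ : 0 ≤ β)
    (F Ft : Fin N → FreqMomentum L M → ℂ)
    {ρ₀ : ℕ} (hρ₀ : ∀ ω : Fin N, ((univ : Finset (Fin N)).filter fun ω' => ∃ q, Ft ω q * Ft ω' q ≠ 0).card ≤ ρ₀)
    (sym : ι → FreqMomentum L M × Fin 2 → ℂ) (s₀ s₁ : ι) (κ : ι → ℝ)
    (hκF : ∀ (t : ι) (Y : SpaceTimeIdx L M × SectorLeg N), Y.2.2 = 0 → ‖sectorGramF L M β Ft (sym t) Y‖ ≤ κ t)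
    (hκG : ∀ (t : ι) (Y : SpaceTimeIdx L M × SectorLeg N), Y.2.2 = 1 → ‖sectorGramG L M β Ft (sym t) Y‖ ≤ κ t)
    (Ga Gb : HubbardGrassmann L M) (s : Fin m → Fin 2)
    (hm₀ : (univ.filter fun i => s i = 0).card = m₀ + 1) (hm₁ : (univ.filter fun i => s i = 1).card = m₁)
    (Z : Fin m → SpaceTimeIdx L M × SectorLeg N) {α : ℝ} (hα : 0 ≤ α)
    (hrow : ∀ X, ∑ Y, ‖((sectorSubMatrix L M β Ft).transpose * normalCovariance L M (sym s₀) * sectorSubMatrix L M β Ft) X Y‖ ≤ α)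
    (hcol : ∀ Y, ∑ X, ‖((sectorSubMatrix L M β Ft).transpose * normalCovariance L M (sym s₀) * sectorSubMatrix L M β Ft) X Y‖ ≤ α)
    {δ : ℝ} (hδ : 0 ≤ δ) (hent : ∀ X Y, ‖((sectorSubMatrix L M β Ft).transpose * normalCovariance L M (sym s₁) * sectorSubMatrix L M β Ft) X Y‖ ≤ δ)
    (Na Nb : ℕ → ℝ) (hNb0 : ∀ k, 0 ≤ Nb k)
    (hNa : ∀ k ∈ Icc (e' + 1) (Nm + 1), ∀ σ₀ : Fin (m₀ + 1) → SectorLeg N, hubbardSectorKernelNorm L M β F (prescribedTuples univ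
      (Fin.append (fun _ : Fin k => (none : Option (SectorLeg N))) (fun j => some (σ₀ j)))) Ga ≤ Na k)
    (hNb : ∀ k ∈ Icc (e' + 1) (Nm + 1), ∀ (ω₀ : SectorLeg N) (τ' : Fin e' → SectorLeg N) (ω₁ : Fin m₁ → SectorLeg N),
      hubbardSectorKernelNorm L M β F (prescribedTuples univ
        (Fin.append (fun i : Fin k => if h : (i : ℕ) < e' + 1 then some ((Fin.cons ω₀ τ' : Fin (e' + 1) → SectorLeg N) ⟨i, h⟩) else none)
          (fun j => some (ω₁ j)))) Gb ≤ Nb k)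
    {x A : ℝ} (hx0 : 0 ≤ x) (hx1 : x < 1) (hA : 0 ≤ A)
    (henv : ∀ k ∈ Icc (e' + 1) (Nm + 1),
      (∑ t, κ t ^ 2) ^ (k - (e' + 1)) * ((imagTimeWeight β M * Na k) * (imagTimeWeight β M * Nb k)) ≤ x ^ (k - (e' + 1)) * A) :
    ∑ i ∈ Icc e' Nm, ((i.factorial : ℝ))⁻¹ *
      ‖kernel ℂ ((grassmannLaplacian ℂ (crossCov ℂ ((sectorSubMatrix L M β Ft).transpose * normalCovariance L M (sym s₁) * sectorSubMatrix L M β Ft)) ^ i *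
          grassmannLaplacian ℂ (crossCov ℂ ((sectorSubMatrix L M β Ft).transpose * normalCovariance L M (sym s₀) * sectorSubMatrix L M β Ft)))
        (dblCopy ℂ 0 (sectorPreimage β F Ga) * dblCopy ℂ 1 (sectorPreimage β F Gb))) m (fun j => (Z j, s j))‖ ≤
      (((m₀ + 1) + m₁ + (e' + 1) + 1).factorial : ℝ) / (m.factorial * (1 - x) ^ ((m₀ + 1) + m₁ + (e' + 1) + 2)) *
        (α * (δ * ((4 * ρ₀ : ℕ) : ℝ)) ^ e' * A) := by
  have h := sum_norm_kernel_crossContract_value_sectorPreimage_le_gramTail_mul (Nmax := Nm + 1) hβ F Ft hρ₀ sym s₀ s₁ κ hκF hκG Ga Gb s hm₀ hm₁ Z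
    hα hrow hcol hδ hent Na Nb hNb0 hNa hNb hx0 hx1 hA henv
  rw [← sum_Icc_succ_shift] at h
  refine le_trans (le_of_eq (sum_congr rfl fun i _ => ?_)) h
  rw [Nat.add_sub_cancel, pow_mul_eq_listProd]

/-- **The same, roles exchanged** (`m₁ + 1 ≥ 1` output legs from `b`; `Ga` read with `e' + 1` explicit contracted sectors, `Gb` at level `m₁ + 1`).
[cite: BenfattoGiulianiMastropietro2006, §2.8 (2.80)] -/
theorem sum_norm_kernel_pow_mul_sectorPreimage_le_gramTail_of_b {e' m m₀ m₁ Nm : ℕ} {β : ℝ} (hβ : 0 ≤ β)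
    (F Ft : Fin N → FreqMomentum L M → ℂ)
    {ρ₀ : ℕ} (hρ₀ : ∀ ω : Fin N, ((univ : Finset (Fin N)).filter fun ω' => ∃ q, Ft ω q * Ft ω' q ≠ 0).card ≤ ρ₀)
    (sym : ι → FreqMomentum L M × Fin 2 → ℂ) (s₀ s₁ : ι) (κ : ι → ℝ)
    (hκF : ∀ (t : ι) (Y : SpaceTimeIdx L M × SectorLeg N), Y.2.2 = 0 → ‖sectorGramF L M β Ft (sym t) Y‖ ≤ κ t)
    (hκG : ∀ (t : ι) (Y : SpaceTimeIdx L M × SectorLeg N), Y.2.2 = 1 → ‖sectorGramG L M β Ft (sym t) Y‖ ≤ κ t)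
    (Ga Gb : HubbardGrassmann L M) (s : Fin m → Fin 2)
    (hm₀ : (univ.filter fun i => s i = 0).card = m₀) (hm₁ : (univ.filter fun i => s i = 1).card = m₁ + 1)
    (Z : Fin m → SpaceTimeIdx L M × SectorLeg N) {α : ℝ} (hα : 0 ≤ α)
    (hrow : ∀ X, ∑ Y, ‖((sectorSubMatrix L M β Ft).transpose * normalCovariance L M (sym s₀) * sectorSubMatrix L M β Ft) X Y‖ ≤ α)
    (hcol : ∀ Y, ∑ X, ‖((sectorSubMatrix L M β Ft).transpose * normalCovariance L M (sym s₀) * sectorSubMatrix L M β Ft) X Y‖ ≤ α)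
    {δ : ℝ} (hδ : 0 ≤ δ) (hent : ∀ X Y, ‖((sectorSubMatrix L M β Ft).transpose * normalCovariance L M (sym s₁) * sectorSubMatrix L M β Ft) X Y‖ ≤ δ)
    (Na Nb : ℕ → ℝ) (hNa0 : ∀ k, 0 ≤ Na k)
    (hNa : ∀ k ∈ Icc (e' + 1) (Nm + 1), ∀ (ω₀ : SectorLeg N) (σ' : Fin e' → SectorLeg N) (ω₁ : Fin m₀ → SectorLeg N),
      hubbardSectorKernelNorm L M β F (prescribedTuples univ
        (Fin.append (fun i : Fin k => if h : (i : ℕ) < e' + 1 then some ((Fin.cons ω₀ σ' : Fin (e' + 1) → SectorLeg N) ⟨i, h⟩) else none)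
          (fun j => some (ω₁ j)))) Ga ≤ Na k)
    (hNb : ∀ k ∈ Icc (e' + 1) (Nm + 1), ∀ σ₁ : Fin (m₁ + 1) → SectorLeg N, hubbardSectorKernelNorm L M β F (prescribedTuples univ
      (Fin.append (fun _ : Fin k => (none : Option (SectorLeg N))) (fun j => some (σ₁ j)))) Gb ≤ Nb k)
    {x A : ℝ} (hx0 : 0 ≤ x) (hx1 : x < 1) (hA : 0 ≤ A)
    (henv : ∀ k ∈ Icc (e' + 1) (Nm + 1),
      (∑ t, κ t ^ 2) ^ (k - (e' + 1)) * ((imagTimeWeight β M * Na k) * (imagTimeWeight β M * Nb k)) ≤ x ^ (k - (e' + 1)) * A) :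
    ∑ i ∈ Icc e' Nm, ((i.factorial : ℝ))⁻¹ *
      ‖kernel ℂ ((grassmannLaplacian ℂ (crossCov ℂ ((sectorSubMatrix L M β Ft).transpose * normalCovariance L M (sym s₁) * sectorSubMatrix L M β Ft)) ^ i *
          grassmannLaplacian ℂ (crossCov ℂ ((sectorSubMatrix L M β Ft).transpose * normalCovariance L M (sym s₀) * sectorSubMatrix L M β Ft)))
        (dblCopy ℂ 0 (sectorPreimage β F Ga) * dblCopy ℂ 1 (sectorPreimage β F Gb))) m (fun j => (Z j, s j))‖ ≤
      ((m₀ + (m₁ + 1) + (e' + 1) + 1).factorial : ℝ) / (m.factorial * (1 - x) ^ (m₀ + (m₁ + 1) + (e' + 1) + 2)) *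
        (α * (δ * ((4 * ρ₀ : ℕ) : ℝ)) ^ e' * A) := by
  have h := sum_norm_kernel_crossContract_value_sectorPreimage_le_gramTail_mul_of_b (Nmax := Nm + 1) hβ F Ft hρ₀ sym s₀ s₁ κ hκF hκG Ga Gb s hm₀ hm₁ Z
    hα hrow hcol hδ hent Na Nb hNa0 hNa hNb hx0 hx1 hA henv
  rw [← sum_Icc_succ_shift] at h
  refine le_trans (le_of_eq (sum_congr rfl fun i _ => ?_)) h
  rw [Nat.add_sub_cancel, pow_mul_eq_listProd]

end Tails

/-! ## §4 The tails of THE block: line `0` = `Ċ_Λ`, soft lines = `C∞ − C_Λ`, both vertices the carrier `W_Λ` (`e' = 2`, four output legs) -/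

section BlockTails

variable {L M N : ℕ} [NeZero L] (β μ : ℝ) (K : TrigPolyC4v) (n₀ : ℕ) (κ : FreqMomentum L M × Fin 2 → ℂ)
  (V : HubbardGrassmann L M) (Λ : ℝ) {ι : Type*} [Fintype ι] [DecidableEq ι]

/-- **The block's tail at a colouring with `m₀ + 1 ≥ 1` legs from copy `0`** — hypothesis `hT` of `norm_klE5Block_le_of_tails` from line data: symbols
`sym s₀` of `Ċ_Λ` (`normalCovariance (sym s₀) = klE5DressedSliceDeriv … Λ`; row/column sums `≤ α`) and `sym s₁` of `C∞ − C_Λ`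
(`normalCovariance (sym s₁) = klE5Total … − klE5DressedSlice … Λ`; entries `≤ δ`), Gram constants `κ`, the carrier's level norms `Na k` (level `m₀+1`)
and `Nb k` (level `3 + m₁`) at line numbers `k ∈ Icc 3 (|idx|+2)`, and the envelope `(Σκ²)^{k−3}(εNa k)(εNb k) ≤ x^{k−3}A`:
`Σ_{i∈Icc 2 (|idx|+1)} (i!)⁻¹‖kernel(…)(Z,s)‖ ≤ ((m₀+m₁+5)!/(4!(1−x)^{m₀+m₁+6}))·(α·(δ·4ρ₀)²·A)`. [cite: BenfattoGiulianiMastropietro2006, §2.8 (2.80)] -/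
theorem klE5_tail_le_of_lineData {m₀ m₁ : ℕ} (hβ : 0 ≤ β) (F Ft : Fin N → FreqMomentum L M → ℂ)
    {ρ₀ : ℕ} (hρ₀ : ∀ ω : Fin N, ((univ : Finset (Fin N)).filter fun ω' => ∃ q, Ft ω q * Ft ω' q ≠ 0).card ≤ ρ₀)
    (sym : ι → FreqMomentum L M × Fin 2 → ℂ) (s₀ s₁ : ι)
    (hs₀ : normalCovariance L M (sym s₀) = klE5DressedSliceDeriv L M β μ K n₀ κ Λ)
    (hs₁ : normalCovariance L M (sym s₁) = klE5Total L M β μ K n₀ κ - klE5DressedSlice L M β μ K n₀ κ Λ)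
    (κg : ι → ℝ)
    (hκF : ∀ (t : ι) (Y : SpaceTimeIdx L M × SectorLeg N), Y.2.2 = 0 → ‖sectorGramF L M β Ft (sym t) Y‖ ≤ κg t)
    (hκG : ∀ (t : ι) (Y : SpaceTimeIdx L M × SectorLeg N), Y.2.2 = 1 → ‖sectorGramG L M β Ft (sym t) Y‖ ≤ κg t)
    (s : Fin 4 → Fin 2) (hm₀ : (univ.filter fun i => s i = 0).card = m₀ + 1) (hm₁ : (univ.filter fun i => s i = 1).card = m₁)
    (Z : Fin 4 → SpaceTimeIdx L M × SectorLeg N) {α : ℝ} (hα : 0 ≤ α)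
    (hrow : ∀ X, ∑ Y, ‖((sectorSubMatrix L M β Ft).transpose * normalCovariance L M (sym s₀) * sectorSubMatrix L M β Ft) X Y‖ ≤ α)
    (hcol : ∀ Y, ∑ X, ‖((sectorSubMatrix L M β Ft).transpose * normalCovariance L M (sym s₀) * sectorSubMatrix L M β Ft) X Y‖ ≤ α)
    {δ : ℝ} (hδ : 0 ≤ δ) (hent : ∀ X Y, ‖((sectorSubMatrix L M β Ft).transpose * normalCovariance L M (sym s₁) * sectorSubMatrix L M β Ft) X Y‖ ≤ δ)
    (Na Nb : ℕ → ℝ) (hNb0 : ∀ k, 0 ≤ Nb k)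
    (hNa : ∀ k ∈ Icc 3 (Fintype.card (HubbardFieldIdx L M × Fin 2) + 2), ∀ σ₀ : Fin (m₀ + 1) → SectorLeg N,
      hubbardSectorKernelNorm L M β F (prescribedTuples univ
        (Fin.append (fun _ : Fin k => (none : Option (SectorLeg N))) (fun j => some (σ₀ j)))) (klE5Carrier L M β μ K n₀ κ V Λ) ≤ Na k)
    (hNb : ∀ k ∈ Icc 3 (Fintype.card (HubbardFieldIdx L M × Fin 2) + 2), ∀ (ω₀ : SectorLeg N) (τ' : Fin 2 → SectorLeg N) (ω₁ : Fin m₁ → SectorLeg N),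
      hubbardSectorKernelNorm L M β F (prescribedTuples univ
        (Fin.append (fun i : Fin k => if h : (i : ℕ) < 3 then some ((Fin.cons ω₀ τ' : Fin 3 → SectorLeg N) ⟨i, h⟩) else none)
          (fun j => some (ω₁ j)))) (klE5Carrier L M β μ K n₀ κ V Λ) ≤ Nb k)
    {x A : ℝ} (hx0 : 0 ≤ x) (hx1 : x < 1) (hA : 0 ≤ A)
    (henv : ∀ k ∈ Icc 3 (Fintype.card (HubbardFieldIdx L M × Fin 2) + 2),
      (∑ t, κg t ^ 2) ^ (k - 3) * ((imagTimeWeight β M * Na k) * (imagTimeWeight β M * Nb k)) ≤ x ^ (k - 3) * A) :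
    ∑ i ∈ Finset.Icc 2 (Fintype.card (HubbardFieldIdx L M × Fin 2) + 1), ((i.factorial : ℝ))⁻¹ *
        ‖kernel ℂ ((grassmannLaplacian ℂ (crossCov ℂ ((sectorSubMatrix L M β Ft).transpose *
              (klE5Total L M β μ K n₀ κ - klE5DressedSlice L M β μ K n₀ κ Λ) * sectorSubMatrix L M β Ft)) ^ i *
            grassmannLaplacian ℂ (crossCov ℂ ((sectorSubMatrix L M β Ft).transpose * klE5DressedSliceDeriv L M β μ K n₀ κ Λ *
              sectorSubMatrix L M β Ft)))
          (dblCopy ℂ 0 (sectorPreimage β F (klE5Carrier L M β μ K n₀ κ V Λ)) *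
            dblCopy ℂ 1 (sectorPreimage β F (klE5Carrier L M β μ K n₀ κ V Λ)))) 4 (fun j => (Z j, s j))‖ ≤
      ((m₀ + m₁ + 5).factorial : ℝ) / ((4 : ℕ).factorial * (1 - x) ^ (m₀ + m₁ + 6)) * (α * (δ * ((4 * ρ₀ : ℕ) : ℝ)) ^ 2 * A) := by
  have h := sum_norm_kernel_pow_mul_sectorPreimage_le_gramTail (e' := 2) (m := 4) (Nm := Fintype.card (HubbardFieldIdx L M × Fin 2) + 1) hβ F Ft hρ₀
    sym s₀ s₁ κg hκF hκG (klE5Carrier L M β μ K n₀ κ V Λ) (klE5Carrier L M β μ K n₀ κ V Λ) s hm₀ hm₁ Z hα hrow hcol hδ hent Na Nb hNb0 hNa hNb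
    hx0 hx1 hA henv
  rw [hs₀, hs₁] at h
  refine h.trans (le_of_eq ?_)
  have e1 : m₀ + 1 + m₁ + (2 + 1) + 1 = m₀ + m₁ + 5 := by ring
  have e2 : m₀ + 1 + m₁ + (2 + 1) + 2 = m₀ + m₁ + 6 := by ring
  rw [e1, e2]

/-- **The block's tail at a colouring with `m₁ + 1 ≥ 1` legs from copy `1`** (roles exchanged: `Na k` at level `3 + m₀`, `Nb k` at level `m₁ + 1`).
[cite: BenfattoGiulianiMastropietro2006, §2.8 (2.80)] -/
theorem klE5_tail_le_of_lineData_of_b {m₀ m₁ : ℕ} (hβ : 0 ≤ β) (F Ft : Fin N → FreqMomentum L M → ℂ)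
    {ρ₀ : ℕ} (hρ₀ : ∀ ω : Fin N, ((univ : Finset (Fin N)).filter fun ω' => ∃ q, Ft ω q * Ft ω' q ≠ 0).card ≤ ρ₀)
    (sym : ι → FreqMomentum L M × Fin 2 → ℂ) (s₀ s₁ : ι)
    (hs₀ : normalCovariance L M (sym s₀) = klE5DressedSliceDeriv L M β μ K n₀ κ Λ)
    (hs₁ : normalCovariance L M (sym s₁) = klE5Total L M β μ K n₀ κ - klE5DressedSlice L M β μ K n₀ κ Λ)
    (κg : ι → ℝ)
    (hκF : ∀ (t : ι) (Y : SpaceTimeIdx L M × SectorLeg N), Y.2.2 = 0 → ‖sectorGramF L M β Ft (sym t) Y‖ ≤ κg t)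
    (hκG : ∀ (t : ι) (Y : SpaceTimeIdx L M × SectorLeg N), Y.2.2 = 1 → ‖sectorGramG L M β Ft (sym t) Y‖ ≤ κg t)
    (s : Fin 4 → Fin 2) (hm₀ : (univ.filter fun i => s i = 0).card = m₀) (hm₁ : (univ.filter fun i => s i = 1).card = m₁ + 1)
    (Z : Fin 4 → SpaceTimeIdx L M × SectorLeg N) {α : ℝ} (hα : 0 ≤ α)
    (hrow : ∀ X, ∑ Y, ‖((sectorSubMatrix L M β Ft).transpose * normalCovariance L M (sym s₀) * sectorSubMatrix L M β Ft) X Y‖ ≤ α)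
    (hcol : ∀ Y, ∑ X, ‖((sectorSubMatrix L M β Ft).transpose * normalCovariance L M (sym s₀) * sectorSubMatrix L M β Ft) X Y‖ ≤ α)
    {δ : ℝ} (hδ : 0 ≤ δ) (hent : ∀ X Y, ‖((sectorSubMatrix L M β Ft).transpose * normalCovariance L M (sym s₁) * sectorSubMatrix L M β Ft) X Y‖ ≤ δ)
    (Na Nb : ℕ → ℝ) (hNa0 : ∀ k, 0 ≤ Na k)
    (hNa : ∀ k ∈ Icc 3 (Fintype.card (HubbardFieldIdx L M × Fin 2) + 2), ∀ (ω₀ : SectorLeg N) (σ' : Fin 2 → SectorLeg N) (ω₁ : Fin m₀ → SectorLeg N),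
      hubbardSectorKernelNorm L M β F (prescribedTuples univ
        (Fin.append (fun i : Fin k => if h : (i : ℕ) < 3 then some ((Fin.cons ω₀ σ' : Fin 3 → SectorLeg N) ⟨i, h⟩) else none)
          (fun j => some (ω₁ j)))) (klE5Carrier L M β μ K n₀ κ V Λ) ≤ Na k)
    (hNb : ∀ k ∈ Icc 3 (Fintype.card (HubbardFieldIdx L M × Fin 2) + 2), ∀ σ₁ : Fin (m₁ + 1) → SectorLeg N,
      hubbardSectorKernelNorm L M β F (prescribedTuples univ
        (Fin.append (fun _ : Fin k => (none : Option (SectorLeg N))) (fun j => some (σ₁ j)))) (klE5Carrier L M β μ K n₀ κ V Λ) ≤ Nb k)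
    {x A : ℝ} (hx0 : 0 ≤ x) (hx1 : x < 1) (hA : 0 ≤ A)
    (henv : ∀ k ∈ Icc 3 (Fintype.card (HubbardFieldIdx L M × Fin 2) + 2),
      (∑ t, κg t ^ 2) ^ (k - 3) * ((imagTimeWeight β M * Na k) * (imagTimeWeight β M * Nb k)) ≤ x ^ (k - 3) * A) :
    ∑ i ∈ Finset.Icc 2 (Fintype.card (HubbardFieldIdx L M × Fin 2) + 1), ((i.factorial : ℝ))⁻¹ *
        ‖kernel ℂ ((grassmannLaplacian ℂ (crossCov ℂ ((sectorSubMatrix L M β Ft).transpose *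
              (klE5Total L M β μ K n₀ κ - klE5DressedSlice L M β μ K n₀ κ Λ) * sectorSubMatrix L M β Ft)) ^ i *
            grassmannLaplacian ℂ (crossCov ℂ ((sectorSubMatrix L M β Ft).transpose * klE5DressedSliceDeriv L M β μ K n₀ κ Λ *
              sectorSubMatrix L M β Ft)))
          (dblCopy ℂ 0 (sectorPreimage β F (klE5Carrier L M β μ K n₀ κ V Λ)) *
            dblCopy ℂ 1 (sectorPreimage β F (klE5Carrier L M β μ K n₀ κ V Λ)))) 4 (fun j => (Z j, s j))‖ ≤
      ((m₀ + m₁ + 5).factorial : ℝ) / ((4 : ℕ).factorial * (1 - x) ^ (m₀ + m₁ + 6)) * (α * (δ * ((4 * ρ₀ : ℕ) : ℝ)) ^ 2 * A) := by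
  have h := sum_norm_kernel_pow_mul_sectorPreimage_le_gramTail_of_b (e' := 2) (m := 4) (Nm := Fintype.card (HubbardFieldIdx L M × Fin 2) + 1) hβ
    F Ft hρ₀ sym s₀ s₁ κg hκF hκG (klE5Carrier L M β μ K n₀ κ V Λ) (klE5Carrier L M β μ K n₀ κ V Λ) s hm₀ hm₁ Z hα hrow hcol hδ hent Na Nb hNa0
    hNa hNb hx0 hx1 hA henv
  rw [hs₀, hs₁] at h
  refine h.trans (le_of_eq ?_)
  have e1 : m₀ + (m₁ + 1) + (2 + 1) + 1 = m₀ + m₁ + 5 := by ring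
  have e2 : m₀ + (m₁ + 1) + (2 + 1) + 2 = m₀ + m₁ + 6 := by ring
  rw [e1, e2]

end BlockTails

end Summit.HubbardSuperconductivity.HubbardSuperconductivity.Theorems.KLRegimeSplit

end
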